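import Mathlib
import Summits.KontsevichZagierPeriods.Zeta5Search.RayFaceKitCover
import Summits.KontsevichZagierPeriods.Zeta5Search.RayC1Levels
import HarnessLib

/-!
# ζ(5) search — RAY FACE KIT III: the T1-map ray C1 `b(n) = n·(85; 35,32,30,27,25,22,20)` (P1 g14)

HONEST FRAMING: systematic search; no irrationality claim unless certified.  Cell `pub-zeta5`, prover seat P1, generation 14.
Integer bookkeeping of net exponents; every kernel exponent the consumers feed stays `< 1` — no irrationality content; nothing
about `ζ(5)`.

Instantiation of the face kit (`RayFaceKit`, `RayFaceKitCover`) for `T1Rays.bRay β1 n`: the block form of its net exponents is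
gen-2 g16's `Ray1Points.netExp_eq` + `blockCount_eq` (blocks `[35n,50n]`, `[32n,53n]`, `[30n,55n]`, `[27n,58n]`, `[25n,60n]`,
`[22n,63n]`, `[20n,65n]`, `b₀ = 85n`), so `c1_cover` turns ONE `decide +kernel` of `faceCheck 85 7 los1 his1 c` into the class-type
cover `Cover (bRay β1 n) p (coverOf 7 c)` on the whole window of the certificate — the input of the window wrappers
`RayC1Levels.ray1_LB / ray1_J / ray1_B` and `RayC1GuardsOI.ray1_O / ray1_I`, replacing the level-by-level `omega` covers of the
machine-generated `RayC1Letters*` files (P1 g13) by a certificate of 17 cuts per face.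
-/

namespace Summit.KontsevichZagierPeriods.Zeta5Search.RayC1FaceKit

open Summit.KontsevichZagierPeriods.Zeta5Search.RayFaceKit
open Summit.KontsevichZagierPeriods.Zeta5Search.ClassTypeCover (Cover)
open Summit.KontsevichZagierPeriods.Zeta5Search.ClusterValuation (netExp)
open Summit.KontsevichZagierPeriods.Zeta5Search.T1Rays (bRay β1 ray1_zero)
open Summit.KontsevichZagierPeriods.Zeta5Search.T1Rays.Ray1Points (netExp_eq blockCount_eq)

/-- Lower block coefficients of ray C1 (block `j` is `[los1[j]·n, his1[j]·n]`). -/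
def los1 : List ℕ := [35, 32, 30, 27, 25, 22, 20]

/-- Upper block coefficients of ray C1. -/
def his1 : List ℕ := [50, 53, 55, 58, 60, 63, 65]

/-- The block form of the net exponents of ray C1 (`Ray1Points.netExp_eq` + `blockCount_eq`). -/
theorem c1_netExp (n q : ℕ) :
    netExp (bRay β1 n) q = 1 - (blockSum 7 los1 his1 n q : ℤ) + if 2 * q = 85 * n then 1 else 0 := by
  rw [netExp_eq, blockCount_eq]; rfl

/-- **Ray-C1 cover from a checked face certificate.** -/
theorem c1_cover (c : FaceCert) (hc : faceCheck 85 7 los1 his1 c = true) {n p : ℕ} [Fact p.Prime]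
    (hn : c.win.N0 ≤ n) (hr : n % 2 = c.win.r) (hp2 : p % 2 = 1) (hA : c.win.a1 * n < c.win.a2 * p)
    (hB : c.win.b2 * p < c.win.b1 * n) : Cover (bRay β1 n) p (coverOf 7 c) :=
  cover_of_faceCheck (B0 := 85) (fun n => ray1_zero n) (fun n q => c1_netExp n q) hc ⟨hn, hA, hB, hr, hp2⟩

end Summit.KontsevichZagierPeriods.Zeta5Search.RayC1FaceKit
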